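import Mathlib
import Literature.MeasureTheory.Integral.HausdorffMomentTheorem

/-!
# Completely monotone sequences are log-convex

A real sequence `a` is *completely monotone* when all its iterated differences alternate in sign,
`(-1)^k Δ^k a (n) ≥ 0` for all `n, k` (`Δ a (n) = a (n+1) - a (n)`), i.e.
`∑_{i ≤ k} (-1)^i C(k,i) a (n+i) ≥ 0` — the hypothesis of Hausdorff's moment theorem as stated in
`Literature.MeasureTheory.Integral.hausdorffMoment_of_alternating`. Such a sequence is LOG-CONVEX:
`a (n+1)² ≤ a (n) · a (n+2)` for every `n`. Proof: by Hausdorff's theorem `a (n) = ∫ tⁿ dμ` for a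
finite positive measure `μ` carried by `[0,1]`, and `(∫ t^{n+1} dμ)² ≤ (∫ tⁿ dμ) (∫ t^{n+2} dμ)` is
the Cauchy–Schwarz inequality, obtained here from the discriminant of the nonnegative quadratic
`s ↦ ∫ tⁿ (t - s)² dμ`.

* `integral_pow_succ_sq_le` — Cauchy–Schwarz for three consecutive moments of a measure on `[0,1]`;
* `sq_le_mul_of_alternating` — completely monotone (alternating-sum form) ⇒ log-convex;
* `neg_one_pow_mul_fwdDiff_iter_eq_sum` — the dictionary
  `(-1)^k Δ^k a (n) = ∑_{i ≤ k} (-1)^i C(k,i) a (n+i)` for Mathlib's forward difference `fwdDiff 1`;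
* `sq_le_mul_of_fwdDiff_alternating` — completely monotone (`(-1)^k Δ^k a ≥ 0` form) ⇒ log-convex.

In particular a positive sequence that is strictly log-concave at one interior index
(`a (n+1)² > a (n) a (n+2)`) is not completely monotone on any range containing `n, n+1, n+2`
(consumer: `Literature.NumberTheory.LFunctions.WangYang2024`, the Taylor coefficients of `Ξ`).

## References

* C. Berg, J. P. R. Christensen, P. Ressel, *Harmonic Analysis on Semigroups*, Springer GTM 100
  (1984), Ch. 4, Prop. 6.11 (Hausdorff's theorem). [BergChristensenRessel1984]
* D. V. Widder, *The Laplace Transform*, Princeton (1941), Ch. III (the moment problem; completely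
  monotone sequences), Ch. IV §16 (logarithmic convexity). [Widder1941]
-/

noncomputable section

open MeasureTheory Set Filter Topology

namespace Literature.MeasureTheory.Integral

open HausdorffMomentTheorem in
/-- **Cauchy–Schwarz for consecutive moments.** For a finite positive measure `μ` carried by
`[0,1]`, `(∫ t^{n+1} dμ)² ≤ (∫ tⁿ dμ) · (∫ t^{n+2} dμ)`: the quadratic
`s ↦ ∫ tⁿ (t - s)² dμ = (∫ tⁿ) s² - 2 (∫ t^{n+1}) s + ∫ t^{n+2}` is nonnegative, so its
discriminant is `≤ 0`. [folklore] -/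
theorem integral_pow_succ_sq_le (μ : Measure ℝ) [IsFiniteMeasure μ]
    (hμ : μ (Icc (0 : ℝ) 1)ᶜ = 0) (n : ℕ) :
    (∫ t, t ^ (n + 1) ∂μ) ^ 2 ≤ (∫ t, t ^ n ∂μ) * ∫ t, t ^ (n + 2) ∂μ := by
  have hi : ∀ m : ℕ, Integrable (fun t : ℝ => t ^ m) μ := integrable_pow_of_Icc hμ
  have hae : ∀ᵐ t ∂μ, t ∈ Icc (0 : ℝ) 1 := by
    rw [ae_iff]
    exact measure_mono_null (fun t ht => ht) hμ
  have key : ∀ s : ℝ, 0 ≤ (∫ t, t ^ n ∂μ) * (s * s) + (-2 * ∫ t, t ^ (n + 1) ∂μ) * s +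
      ∫ t, t ^ (n + 2) ∂μ := by
    intro s
    have h1 : 0 ≤ ∫ t, t ^ n * (t - s) ^ 2 ∂μ := by
      refine integral_nonneg_of_ae ?_
      filter_upwards [hae] with t ht
      exact mul_nonneg (pow_nonneg ht.1 _) (sq_nonneg _)
    have h2 : ∫ t, t ^ n * (t - s) ^ 2 ∂μ =
        (s * s) * ∫ t, t ^ n ∂μ + (-2 * s) * ∫ t, t ^ (n + 1) ∂μ + ∫ t, t ^ (n + 2) ∂μ := by
      have e : ∀ t : ℝ, t ^ n * (t - s) ^ 2 =
          (s * s) * t ^ n + (-2 * s) * t ^ (n + 1) + t ^ (n + 2) := by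
        intro t
        ring
      have iA : Integrable (fun t : ℝ => (s * s) * t ^ n) μ := (hi n).const_mul _
      have iB : Integrable (fun t : ℝ => (-2 * s) * t ^ (n + 1)) μ := (hi (n + 1)).const_mul _
      have iAB : Integrable (fun t : ℝ => (s * s) * t ^ n + (-2 * s) * t ^ (n + 1)) μ := iA.add iB
      simp_rw [e]
      rw [integral_add iAB (hi (n + 2)), integral_add iA iB, integral_const_mul, integral_const_mul]
    rw [h2] at h1
    linarith
  have hd := discrim_le_zero key
  rw [discrim] at hd
  nlinarith [hd]

/-- **Completely monotone sequences are log-convex.** If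
`∑_{i ≤ k} (-1)^i C(k,i) a (n+i) ≥ 0` for all `n, k`, then `a (n+1)² ≤ a (n) a (n+2)` for all `n`:
Hausdorff's theorem (`hausdorffMoment_of_alternating`) writes `a (n) = ∫ tⁿ dμ` on `[0,1]`, and
Cauchy–Schwarz (`integral_pow_succ_sq_le`) concludes. [folklore] -/
theorem sq_le_mul_of_alternating (a : ℕ → ℝ)
    (hCM : ∀ n k : ℕ, 0 ≤ ∑ i ∈ Finset.range (k + 1), (-1 : ℝ) ^ i * (k.choose i : ℝ) * a (n + i))
    (n : ℕ) : a (n + 1) ^ 2 ≤ a n * a (n + 2) := by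
  obtain ⟨μ, hfin, hμ, ha⟩ := hausdorffMoment_of_alternating a hCM
  rw [ha, ha, ha]
  exact integral_pow_succ_sq_le μ hμ n

/-- **The two forms of complete monotonicity agree termwise**: for the forward difference
`Δ = fwdDiff 1`, `(Δ a) (n) = a (n+1) - a (n)`, one has
`(-1)^k (Δ^k a) (n) = ∑_{i ≤ k} (-1)^i C(k,i) a (n+i)` (from Mathlib's
`fwdDiff_iter_eq_sum_shift`, `Δ^k a (n) = ∑ (-1)^{k-i} C(k,i) a (n+i)`). [folklore] -/
theorem neg_one_pow_mul_fwdDiff_iter_eq_sum (a : ℕ → ℝ) (k n : ℕ) :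
    (-1 : ℝ) ^ k * (fwdDiff 1)^[k] a n =
      ∑ i ∈ Finset.range (k + 1), (-1 : ℝ) ^ i * (k.choose i : ℝ) * a (n + i) := by
  rw [fwdDiff_iter_eq_sum_shift, Finset.mul_sum]
  refine Finset.sum_congr rfl fun i hi => ?_
  have hik : i ≤ k := Nat.lt_succ_iff.mp (Finset.mem_range.mp hi)
  rw [zsmul_eq_mul, smul_eq_mul, mul_one]
  push_cast
  obtain ⟨m, rfl⟩ := Nat.exists_eq_add_of_le hik
  rw [Nat.add_sub_cancel_left, pow_add]
  have hm : (-1 : ℝ) ^ m * (-1) ^ m = 1 := by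
    rw [← pow_add, Even.neg_one_pow ⟨m, rfl⟩]
  linear_combination ((-1 : ℝ) ^ i * ((i + m).choose i : ℝ) * a (n + i)) * hm

/-- **Completely monotone sequences are log-convex**, forward-difference form: if
`(-1)^k (Δ^k a) (n) ≥ 0` for all `k, n` (`Δ = fwdDiff 1`), then `a (n+1)² ≤ a (n) a (n+2)` for all
`n`. [folklore] -/
theorem sq_le_mul_of_fwdDiff_alternating (a : ℕ → ℝ)
    (h : ∀ k n : ℕ, 0 ≤ (-1 : ℝ) ^ k * (fwdDiff 1)^[k] a n) (n : ℕ) :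
    a (n + 1) ^ 2 ≤ a n * a (n + 2) :=
  sq_le_mul_of_alternating a (fun n k => neg_one_pow_mul_fwdDiff_iter_eq_sum a k n ▸ h k n) n

/-- Contrapositive, the form used to refute complete-monotonicity claims: a sequence that is
strictly log-concave at one index, `a (n) a (n+2) < a (n+1)²`, is not completely monotone.
[folklore] -/
theorem not_fwdDiff_alternating_of_mul_lt_sq (a : ℕ → ℝ) {n : ℕ}
    (hn : a n * a (n + 2) < a (n + 1) ^ 2) :
    ¬ ∀ k n : ℕ, 0 ≤ (-1 : ℝ) ^ k * (fwdDiff 1)^[k] a n :=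
  fun h => absurd (sq_le_mul_of_fwdDiff_alternating a h n) (not_le.mpr hn)

end Literature.MeasureTheory.Integral

end
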